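import Summits.BirchSwinnertonDyer.Rank1Residual.Additive.GordCycLowerBound
import Summits.BirchSwinnertonDyer.Rank1Residual.AdditivePotMult.PotMultDelbourgo2002Bridge
import Summits.BirchSwinnertonDyer.Rank1Residual.AdditivePotMult.RankOneIrreducibleLowerHalves
import HarnessLib

/-!
# O7-ord ∩ X4(M), rank ONE, EVERY odd prime: `BSD(E,p)` from PUBLISHED theorems plus EXACTLY the
# Eisenstein half of Delbourgo's Main Conjecture ∘ BS-D(p) — for `E` (rank-one form, with the Schneider
# rider) and for its same-`j` rank-zero twists (rank-zero form) (cell `b2b-bsdres`, team n1011, seat p01,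
# OWNERS row T-O7 / absorbed T-O7b)

HONEST FRAMING (cell `b2b-bsdres`, run/shared/lean/b2b/bsd-rank1-residual/, verbatim in every
file): prove what is provable now; shrink each hard class to its core with data; no claim beyond
stated classes. Research routes; census output = EVIDENCE / conjecture items, never a Literature
fact; RESIDUAL-MAP marks change only by signed lines. §I O7 stays OPEN; X4(M) stays
CONSTRUCTION-SHAPED; nothing is booked; no label changes. COVERAGE (stated first, referee 1
proviso): X4(M) = X4 ∧ `ord_p j < 0` at ANY ODD `p` — INCLUDING `p = 3`, where O7's bulk lives — is
covered, because the only Literature binder with a restriction, n1011-p16's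
`Delbourgo2002.mainTheorem_potMult` (Delbourgo, J. Number Theory 95 (2002) Thm. (A)+(B), `ord_p j < 0`),
is typed for every odd `p` (bridge `PotMult.delbourgo2002`); the side conditions that remain are the
Manin datum `p ∤ c(D)` and `p ∤ ∏c_ℓ(E)` of additive-p1's rank-one Kolyvagin route, and the Schneider
rider (explicit EVIDENCE binder). X3♯(M) (reducible `E[p]`) is NOT covered (no rank-one upper half in
print without irreducibility). Theorems only; no definition, no named fact, no `_holds`.

## What

`ClassX4M.bsdp_rankOne_of_cycLowerBounds` (any odd `p`): for `(E,p) ∈ X4(M)`, `ord_{s=1}L(E,s) = 1`,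
datum `D` at level `N_E` with `p ∤ c(D)`, `p ∤ ∏c_ℓ(E)`:
**`BSD(E,p)` ⟸ [for every height datum `Dh` with Delbourgo's (B)-clauses: `Reg_p(Dh) ≠ 0` ∧
`CycLowerBoundAt E p Dh`] ∧ [for every X4(M) pair `(V,p)` with `j(V) = j(E)`, `r_an(V) = 0`, and every
`DhV` with the (B)-clauses: `CycLowerBoundAt V p DhV`]**, all other inputs PUBLISHED and named:
Delbourgo 2002 (A)+(B) [(M)] (`hDelM`), Gross–Zagier (`hGZ`), Kolyvagin (`hKo`), Matar–Nekovář 2019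
Thm. 0.3 (`hMN`, Kolyvagin's bound for irreducible `E[p]`), Gross–Zagier–Kolyvagin (`hGZK`),
modularity (`hmod`, `hnf`), Hoffstein–Luo (`hHL`). Chain: the lower half of `E`
(`GordCycLowerBound.missingLowerBoundAt_of_cycLowerBound` through p16's bridge, `ℓ = 1` on (M)) and the
lower halves of the rank-zero twists (same, rank-`0` form: no rider) feed additive-p1's
`bsdp_of_classX4M_rankOne_of_lower_of_lowerTwists_of_odd` (rank-one UPPER half = Kolyvagin / Matar–
Nekovář over a Hoffstein–Luo Heegner field, the twists being X4(M) pairs with the same `j`). So on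
O7-ord ∩ X4(M) the class-level missing object is, in the kernel, EXACTLY the Eisenstein half of
Delbourgo's (M) Main Conjecture at `T = 0` / BS-D(p)(ii) — X_E1 of RESIDUAL-MAP §E — for `E` and its
rank-zero twists (plus the unit side conditions and the rider).

## T-O7b (the e = 2 descent reading) — why the over-`K` route does NOT shortcut this

The descent theorem of additive-p1 (`bsdp_of_pPartOver_of_bsdp_twist`, any rank `≤ 1`) converts
`BSD(E,p)` on every e = 2 row into `BSD(E^{(p*)},p)` at a MULTIPLICATIVE / GOOD ORDINARY prime plus
the typed over-`K` input `MissingPPartOverAt (E_K) p`, `K = ℚ(√p*)` — a quadratic field in which `p`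
RAMIFIES. In analytic rank one NO printed theorem reaches that input, because every Heegner-point /
anticyclotomic result in print puts `p` (indeed every prime of bad reduction) OUTSIDE the
discriminant of the quadratic field: Gross, *Kolyvagin's work on modular elliptic curves* (Durham
1989 volume, 1991) §1: "`K = ℚ(√−D)` … an imaginary quadratic field of discriminant `−D`, where all
prime factors of `N` are split"; McCallum, *Kolyvagin's work on Shafarevich–Tate groups* (same volume)
§1: "a quadratic imaginary field in which all the prime factors of `N` are split"; Jetchev–Skinner–Wan,
Camb. J. Math. 5 (2017) §4.1: hypothesis (H) and "Implicit in the second of these assumptions is that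
the discriminant `−D_K < 0` of `K` satisfies `(N, D_K) = 1` (coprime)", §5.1 "`K` … such that `p`
splits in `K`", §7.4.1 (c) "`p` splits in `K′`". (The team's r3 planner line — anticyclotomic theory
at an additive `p` SPLIT in an auxiliary `K` — is a different route and is not prejudged here.)

References: [Delbourgo2002] Thm. (A), (B) (p. 40), p. 39; [MatarNekovar2019] Thm. 0.3; [HoffsteinLuo1997];
[GrossLMS1991] §1; [McCallumLMS1991] §1; [JetchevSkinnerWan2017] §4.1, §5.1, §7.4.1;
[Miller2011LMS] Def. 1.1.
-/

noncomputable section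

open scoped Classical NumberField

open WeierstrassCurve NumberField Literature.NumberTheory.EllipticCurves
  Literature.NumberTheory.EllipticCurves.ModularForms
  Literature.NumberTheory.EllipticCurves.Rank1Residual
  Literature.NumberTheory.EllipticCurves.Rank1Residual.Typed
  Literature.NumberTheory.EllipticCurves.Delbourgo2002
  Literature.NumberTheory.Automorphic
  IsDedekindDomain

namespace Summit.BirchSwinnertonDyer.Rank1Residual.AdditivePotMult

open Additive

variable {W : WeierstrassCurve ℚ} [W.IsElliptic] [W.IsGloballyMinimal] {p : ℕ} [hp : Fact p.Prime]

/-- **(M), RANK ZERO, any odd `p`: the lower half from the typed input, NO rider** (the regulator of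
every height datum is `1` in rank `0`). Delbourgo 2002 (A)+(B) [(M)] via p16's bridge, `ℓ = 1` on (M)
(`PotMult.reductionNonAnomalous`), GZK. At `r_an = 0` the input is additive-p2's
`CycLowerLeadingTermAt` (bridge `cycLowerBoundAt_iff_cycLowerLeadingTermAt_of_rankZero`).
[cite: Delbourgo2002, Theorem (A), (B) (p. 40), Hypothesis (p. 39)] [cite: Miller2011LMS, Def. 1.1] -/
theorem PotMult.missingLowerBoundAt_rankZero_of_cycLowerBound
    (hDelM : Delbourgo2002.mainTheorem_potMult) (hGZK : rank_eq_analyticRank_of_analyticRank_le_one)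
    (hpm : PotMult W p) (hp2 : p ≠ 2) (hr : W.analyticRank = 0)
    (hlow : ∀ Dh : PAdicHeightData W p, LeadingTermClauses W p Dh → CycLowerBoundAt W p Dh) :
    MissingLowerBoundAt W p := by
  obtain ⟨hA, Dh, hB⟩ := hpm.delbourgo2002 hDelM hp2
  exact Additive.missingLowerBoundAt_rankZero_of_cycLowerBound W p hB hA hGZK hr
    hpm.reductionNonAnomalous (hlow Dh hB)

/-- **O7-ord ∩ X4(M), RANK ONE, ANY odd `p` (incl. `p = 3`): `BSD(E,p)` from published theorems plus
EXACTLY the typed Eisenstein halves.** For `(E,p) ∈ X4(M)` (`W` globally minimal; additive at the odd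
prime `p`, `E[p]` irreducible, `ord_p j < 0`), `ord_{s=1} L(E,s) = 1`, a parametrisation datum `D` at
level `N_E` with `p ∤ c(D)` and `p ∤ ∏_ℓ c_ℓ(E)`: IF (i) for every height datum `Dh` satisfying the
clauses of Delbourgo 2002 Thm. (B) the regulator is non-degenerate (the rider — EVIDENCE binder) and
`CycLowerBoundAt W p Dh` holds, AND (ii) every rank-zero X4(M) pair `(V,p)` with `j(V) = j(E)`
satisfies `CycLowerBoundAt V p DhV` for every datum `DhV` with the (B)-clauses, THEN `BSDp W p`.
Published binders: Delbourgo 2002 (A)+(B) potentially multiplicative case (`hDelM`), Gross–Zagier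
(`hGZ`), Kolyvagin (`hKo`), Matar–Nekovář 2019 Thm. 0.3 (`hMN`), GZK (`hGZK`), modularity (`hmod`,
`hnf`), Hoffstein–Luo (`hHL`). X4(M) stays CONSTRUCTION-SHAPED; nothing booked.
[cite: Delbourgo2002, Theorem (A), (B) (p. 40), Hypothesis (p. 39)]
[cite: MatarNekovar2019, Thm. 0.3 (p. 456), §0.11 (p. 457)] [cite: HoffsteinLuo1997, Theorem (§1, pp. 435–436)]
[cite: Miller2011LMS, Def. 1.1] -/
theorem ClassX4M.bsdp_rankOne_of_cycLowerBounds
    (hDelM : Delbourgo2002.mainTheorem_potMult)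
    (hGZ : ∀ (N : ℕ) [NeZero N] (W : WeierstrassCurve ℚ) (K : Type) [Field K] [NumberField K],
      gross_zagier N W K)
    (hKo : ∀ (N : ℕ) [NeZero N] (W : WeierstrassCurve ℚ) (K : Type) [Field K] [NumberField K],
      kolyvagin N W K)
    (hMN : ∀ (N : ℕ) [NeZero N] (W : WeierstrassCurve ℚ) (K : Type) [Field K] [NumberField K],
      MatarNekovar2019.thm03_padicValNat_card_sha_le_of_irreducible N W K)
    (hGZK : rank_eq_analyticRank_of_analyticRank_le_one) (hmod : hasEntireLFunction_rat)
    (hnf : exists_isNewformOf) (hHL : HoffsteinLuo1997_exists_twist_L_one_ne_zero)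
    [NeZero (W.conductorNorm ℤ)]
    (hX : ClassX4M W p) (hr : W.analyticRank = 1)
    (D : ModularParametrizationData W (W.conductorNorm ℤ)) (hc : ¬ (p : ℤ) ∣ D.c)
    (htam : ¬ p ∣ W.tamagawaProduct)
    (hlowE : ∀ Dh : PAdicHeightData W p, LeadingTermClauses W p Dh →
      SchneiderConjecture Dh ∧ CycLowerBoundAt W p Dh)
    (hlowV : ∀ (V : WeierstrassCurve ℚ) [V.IsElliptic] [V.IsGloballyMinimal], ClassX4M V p →
      V.j = W.j → V.analyticRank = 0 →
      ∀ DhV : PAdicHeightData V p, LeadingTermClauses V p DhV → CycLowerBoundAt V p DhV) :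
    BSDp W p := by
  have hp2 : p ≠ 2 := hX.p_ne_two
  -- the lower half of `E` itself (rank-one form, rider explicit)
  have hlowW : MissingLowerBoundAt W p := by
    obtain ⟨hA, Dh, hB⟩ := hX.potMult.delbourgo2002 hDelM hp2
    obtain ⟨hS, hlowDh⟩ := hlowE Dh hB
    exact Additive.missingLowerBoundAt_of_cycLowerBound W p hB hS hA hGZK (by rw [hr])
      hX.potMult.reductionNonAnomalous hlowDh
  -- the lower halves of the same-`j` rank-zero twists (rank-zero form, no rider), then additive-p1
  exact bsdp_of_classX4M_rankOne_of_lower_of_lowerTwists_of_odd hGZ hKo hMN hGZK hmod hnf hHL hX hr D hc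
    htam hlowW fun V _ _ hXV hj hrV ↦
      PotMult.missingLowerBoundAt_rankZero_of_cycLowerBound hDelM hGZK hXV.potMult hXV.p_ne_two hrV
        (hlowV V hXV hj hrV)

end Summit.BirchSwinnertonDyer.Rank1Residual.AdditivePotMult

end
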